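import Mathlib
import HarnessLib
import Literature.Analysis.Convex.Subgradient
import Literature.Analysis.Convex.MonotoneOperatorResolvent

/-!
# The Baillon–Haddad theorem: Lipschitz gradients of convex functions are cocoercive

Literature anchor (statements follow the sources; the proof route is the elementary one, see
PROOF ROUTE; nothing here is new mathematics):

* [BH77] J.-B. Baillon, G. Haddad, *Quelques propriétés des opérateurs angle-bornés et
  n-cycliquement monotones*, Israel J. Math. **26** (1977) 137–150, Corollaire 10 (bib key
  `BaillonHaddad1977`; cited through [BC10, Thm 1.1] and [WW22, §1]).
* [BC10] H. H. Bauschke, P. L. Combettes, *The Baillon–Haddad theorem revisited*, J. Convex Anal.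
  **17** (2010) 781–787, arXiv:0906.0807 (bib key `BauschkeCombettes2010`; held, `lit` key
  `paper:arxiv-0906.0807`, pp. 3–4): §1 (cocoercivity (1.1), Lipschitz continuity (1.2)),
  Theorem 1.1 (Baillon–Haddad), Theorem 2.1 ((i) `∇f` `β`-Lipschitz ⟺ (ii) `βq − f` convex ⟺ …
  ⟺ (vi) `∇f` `1/β`-cocoercive, `q = ½‖·‖²`), Remark 2.2.
* [WW22] D. Wachsmuth, G. Wachsmuth, *A simple proof of the Baillon–Haddad theorem on open subsets
  of Hilbert spaces*, arXiv:2204.00282 (bib key `WachsmuthWachsmuth2022`; held, `lit` key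
  `paper:arxiv-2204.00282`): Lemma 2.1 (`f′` `L`-Lipschitz ⟹ `|f(y) − f(x) − ⟨f′(x), y − x⟩| ≤
  (L/2)‖y − x‖²`, p. 2), Lemma 2.3 (`T` is `1/L`-cocoercive ⟺ `2T/L − R` is nonexpansive, p. 4),
  Theorem 2.5 ((i) `f′` `L`-Lipschitz ⟺ (ii) `(L/2)‖·‖² − f` convex ⟺ (iii) `f′`
  `1/L`-cocoercive, p. 5), Theorem 3.1 ((ii) the descent lemma, (vi) `f(y) ≥ f(x) +
  ⟨x⋆, y − x⟩ + (1/2L)‖y⋆ − x⋆‖²`; (c): on `O = X` all assertions are equivalent, pp. 6–7).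
* [Com18] P. L. Combettes, *Monotone operator theory in convex optimization*, Math. Program.
  **170** (2018), arXiv:1802.02694 (bib key `Combettes2018`; held, p. 4): Theorem 2.2 ([BC10]
  with `β = 1`: `∇h` nonexpansive ⟺ `∇h` firmly nonexpansive ⟺ `q − h` convex ⟺ …).
* [Nes04] Yu. Nesterov, *Introductory Lectures on Convex Optimization*, Kluwer 2004, Thm 2.1.5
  (bib key `Nesterov2004`; not held) — the textbook source of the elementary route below.

THE RESULT [BC10, Theorem 1.1 (Baillon–Haddad) [Bail77]].  *Let `f : 𝓗 → ℝ` be convex, Fréchet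
differentiable on `𝓗`, and such that `∇f` is `β`-Lipschitz continuous for some `β ∈ ℝ₊₊`.  Then
`∇f` is `1/β`-cocoercive*, i.e. [BC10, (1.1)] `β⟨x − y | ∇f x − ∇f y⟩ ≥ ‖∇f x − ∇f y‖²` for all
`x, y`.  "It follows from the Cauchy–Schwarz inequality that `1/β`-cocoercivity implies
`β`-Lipschitz continuity.  However, the converse fails; take for instance `T = −Id` … In 1977,
Baillon and Haddad showed that, if `C = 𝓗` and `T` is the gradient of a convex function, then
(1.1) and (1.2) coincide." [BC10, §1].

## What is formalised (namespace `Literature.Analysis.Convex.BaillonHaddad`; `E` a real inner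
product space, complete where gradients occur; `f : E → ℝ` with `hg : ∀ x, HasGradientAt f (g x) x`
— Fréchet differentiability with Riesz gradient `g = ∇f`; Lipschitz constants `L : ℝ≥0` through
Mathlib's `LipschitzWith`)

* `IsCocoercive μ T` (`μ‖Tx − Ty‖² ≤ ⟪x − y, Tx − Ty⟫`, [BC10, (1.1)] with `μ = 1/β`) and its
  elementary theory: `isCocoercive_one_iff_isFirmlyNonexpansive_graph` (dictionary to
  `MonotoneOperator.IsFirmlyNonexpansive (graph T)` of
  `Literature.Analysis.Convex.MonotoneOperatorResolvent`), `IsCocoercive.inner_nonneg`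
  (monotone), `IsCocoercive.lipschitzWith` ([BC10, Thm 2.1 (vi)⇒(i)], Cauchy–Schwarz),
  `isCocoercive_iff_norm_sub_le` ([WW22, Lemma 2.3]: `1/L`-cocoercive ⟺ `(2/L)T − I`
  nonexpansive), `IsCocoercive.norm_forwardStep_sub_le` (`I − γT` nonexpansive for
  `0 ≤ γ ≤ 2/L`).
* LIPSCHITZ GRADIENT, NO CONVEXITY: `abs_sub_sub_inner_le` ([WW22, Lemma 2.1 (i)⇒(iii)]:
  `|f y − f x − ⟪∇f x, y − x⟫| ≤ (L/2)‖y − x‖²`), `le_add_inner_add_of_lipschitzWith` (the descent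
  lemma, [WW22, Thm 3.1 (ii)]), `convexOn_half_sq_sub_iff` (for differentiable `f` and any real
  `L`: `(L/2)‖·‖² − f` convex ⟺ the descent bound — the computation in the proof of
  [WW22, Thm 2.5 (i)⇔(ii)]), `convexOn_half_sq_sub_of_lipschitzWith` ([BC10, Thm 2.1 (i)⇒(ii)]).
* CONVEX `f`: `add_inner_add_norm_sub_sq_le` (the interpolation inequality [WW22, Thm 3.1 (vi)],
  [Nes04, Thm 2.1.5]: descent bound + convexity ⟹ `f x + ⟪∇f x, y − x⟫ + (1/2L)‖∇f y − ∇f x‖²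
  ≤ f y`), **`isCocoercive_of_convexOn`** (THE BAILLON–HADDAD THEOREM: `IsCocoercive (1/L) ∇f`),
  `norm_sub_sq_le_mul_inner` (product form `‖∇f x − ∇f y‖² ≤ L⟪x − y, ∇f x − ∇f y⟫`, all
  `L ≥ 0`), `lipschitzWith_iff_isCocoercive` ([BC10, Thm 2.1 (i)⇔(vi)], `L > 0`),
  `lipschitzWith_iff_convexOn_half_sq_sub` ([WW22, Thm 2.5 (i)⇔(ii)], `L > 0`),
  `isFirmlyNonexpansive_graph_of_convexOn` ([Com18, Thm 2.2 (i)⇒(ii)]: `L = 1`, graph form),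
  `norm_gradientStep_sub_le` (the gradient step `x ↦ x − γ∇f x` is nonexpansive for
  `0 ≤ γ ≤ 2/L`, cf. [BC10, Remark 2.2 (c)]).

PROOF ROUTE AND DEVIATIONS.  (1) [WW22, Lemma 2.1 (i)⇒(iii)] is proved without the integral:
for `|σ| ≤ 1` the real function `t ↦ σ(f(x + tv) − f(x) − t⟪∇f x, v⟫) − (L/2)t²‖v‖²` has
derivative `σ⟪∇f(x + tv) − ∇f x, v⟫ − Lt‖v‖² ≤ 0` for `t > 0` (Cauchy–Schwarz and the Lipschitz
bound), hence is non-increasing on `[0, ∞)` (Mathlib's `antitoneOn_of_deriv_nonpos`), and its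
value at `t = 1` is `≤` its value `0` at `t = 0`.  (2) The theorem itself is obtained along the
elementary route of [Nes04, Thm 2.1.5] (= [WW22, Thm 3.1 (ii)⇒(vi)⇒(v)] on `O = X`): the
descent bound at the point `y − (1/L)(∇f y − ∇f x)` combined with the tangent inequality of
the convex `f` at `x` (`Literature.Analysis.Convex.ConvexOn.apply_add_fderiv_le`) gives the
interpolation inequality, and adding it to its copy with `x, y` exchanged gives cocoercivity —
not along [BC10]'s proof through conjugates and Moreau envelopes, nor [WW22]'s parallelogram
argument for Lemma 2.1 (iii)⇒(i).  (3) Not formalised: [BC10, Thm 2.1 (iii)–(v)] (the conjugate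
`f*`, Moreau envelopes and `prox`, absent from Mathlib), the second-order variant [BC10, §3], and
the open-subset setting `O ⊊ H` of [WW22] (here `O = H` throughout).  (4) Constants: `1/L` and
`2/L` are real divisions with Lean's `1/0 = 0`; the statements marked "`L > 0`" need it, the
others hold as stated for every `L ≥ 0` (for `L = 0` the gradient is constant).  Everything is
proved; there are no named facts and no `sorry`.
-/

noncomputable section

open Set InnerProductSpace

open scoped RealInnerProductSpace NNReal

namespace Literature.Analysis.Convex.BaillonHaddad

variable {E : Type*} [NormedAddCommGroup E] [InnerProductSpace ℝ E]

/-- `T : E → E` is `μ`-cocoercive: `μ‖Tx − Ty‖² ≤ ⟪x − y, Tx − Ty⟫` for all `x y` (so `1`-cocoercive =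
firmly nonexpansive, and `∇f` "`1/β`-cocoercive" in the sources' wording is `IsCocoercive (1/β) ∇f`).
[cite: BauschkeCombettes2010, §1 (1.1)] -/
def IsCocoercive (μ : ℝ) (T : E → E) : Prop :=
  ∀ x y, μ * ‖T x - T y‖ ^ 2 ≤ ⟪x - y, T x - T y⟫

/-! ## Cocoercive operators: elementary facts (no differentiability, no completeness) -/

section Elementary

variable {T : E → E} {L γ : ℝ}

/-- `1`-cocoercive is firmly nonexpansive in the graph language of
`Literature.Analysis.Convex.MonotoneOperatorResolvent`. [cite: BauschkeCombettes2010, §1 (after (1.2))] -/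
theorem isCocoercive_one_iff_isFirmlyNonexpansive_graph :
    IsCocoercive 1 T ↔ MonotoneOperator.IsFirmlyNonexpansive (MonotoneOperator.graph T) := by
  constructor
  · rintro h x y (rfl : y = T x) x' y' (rfl : y' = T x')
    simpa using h x' x
  · intro h x y
    simpa using h (show (y, T y) ∈ MonotoneOperator.graph T from rfl)
      (show (x, T x) ∈ MonotoneOperator.graph T from rfl)

/-- A cocoercive operator with nonnegative constant is monotone. [cite: BauschkeCombettes2010, §1] -/
theorem IsCocoercive.inner_nonneg {μ : ℝ} (h : IsCocoercive μ T) (hμ : 0 ≤ μ) (x y : E) :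
    0 ≤ ⟪x - y, T x - T y⟫ :=
  (mul_nonneg hμ (sq_nonneg _)).trans (h x y)

/-- Cauchy–Schwarz: a `1/L`-cocoercive operator is `L`-Lipschitz.
[cite: BauschkeCombettes2010, Thm 2.1 (vi)⇒(i)] -/
theorem IsCocoercive.lipschitzWith {L : ℝ≥0} (hL : 0 < L) (h : IsCocoercive (1 / (L : ℝ)) T) :
    LipschitzWith L T := by
  refine LipschitzWith.of_dist_le_mul fun x y => ?_
  rw [dist_eq_norm, dist_eq_norm]
  have hL' : (0 : ℝ) < L := hL
  have h2 : ⟪x - y, T x - T y⟫ ≤ ‖x - y‖ * ‖T x - T y‖ := real_inner_le_norm _ _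
  have h3 : ‖T x - T y‖ ^ 2 ≤ (L : ℝ) * (‖x - y‖ * ‖T x - T y‖) := by
    have := mul_le_mul_of_nonneg_left ((h x y).trans h2) hL'.le
    rwa [← mul_assoc, mul_one_div_cancel hL'.ne', one_mul] at this
  nlinarith [norm_nonneg (T x - T y), mul_nonneg hL'.le (norm_nonneg (x - y))]

/-- The identity behind [WW22, Lemma 2.3]:
`‖(2/L)(Tx − Ty) − (x − y)‖² = ‖x − y‖² − (4/L)(⟪x − y, Tx − Ty⟫ − (1/L)‖Tx − Ty‖²)`. [folklore] -/
private theorem norm_reflect_sub_sq (hL : L ≠ 0) (x y : E) :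
    ‖((2 / L) • T x - x) - ((2 / L) • T y - y)‖ ^ 2 =
      ‖x - y‖ ^ 2 - 4 / L * (⟪x - y, T x - T y⟫ - 1 / L * ‖T x - T y‖ ^ 2) := by
  have e : ((2 / L) • T x - x) - ((2 / L) • T y - y) = (2 / L) • (T x - T y) - (x - y) := by
    rw [smul_sub]; abel
  rw [e, norm_sub_sq_real, norm_smul, real_inner_smul_left, Real.norm_eq_abs, real_inner_comm]
  have : |2 / L| ^ 2 = (2 / L) ^ 2 := sq_abs _
  rw [mul_pow, this]
  field_simp
  ring

/-- `T` is `1/L`-cocoercive iff `(2/L) T − I` is nonexpansive (`L > 0`).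
[cite: WachsmuthWachsmuth2022, Lemma 2.3] -/
theorem isCocoercive_iff_norm_sub_le (hL : 0 < L) :
    IsCocoercive (1 / L) T ↔ ∀ x y, ‖((2 / L) • T x - x) - ((2 / L) • T y - y)‖ ≤ ‖x - y‖ := by
  have h4 : 0 < 4 / L := by positivity
  refine ⟨fun h x y => ?_, fun h x y => ?_⟩
  · refine (sq_le_sq₀ (norm_nonneg _) (norm_nonneg _)).1 ?_
    rw [norm_reflect_sub_sq hL.ne']
    nlinarith [h x y]
  · have h1 := (sq_le_sq₀ (norm_nonneg _) (norm_nonneg _)).2 (h x y)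
    rw [norm_reflect_sub_sq hL.ne'] at h1
    nlinarith [h1]

/-- The gradient / forward step `I − γT` of a `1/L`-cocoercive operator is nonexpansive for
`0 ≤ γ ≤ 2/L`. [cite: WachsmuthWachsmuth2022, Lemma 2.3 (then convex combination with `I`)] -/
theorem IsCocoercive.norm_forwardStep_sub_le (h : IsCocoercive (1 / L) T) (hγ : 0 ≤ γ)
    (hγL : γ ≤ 2 / L) (x y : E) : ‖(x - γ • T x) - (y - γ • T y)‖ ≤ ‖x - y‖ := by
  refine (sq_le_sq₀ (norm_nonneg _) (norm_nonneg _)).1 ?_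
  have e : (x - γ • T x) - (y - γ • T y) = (x - y) - γ • (T x - T y) := by rw [smul_sub]; abel
  rw [e, norm_sub_sq_real, norm_smul, real_inner_smul_right, Real.norm_eq_abs, abs_of_nonneg hγ,
    mul_pow]
  have h1 := h x y
  have h2 : γ ^ 2 ≤ γ * (2 / L) := by rw [sq]; exact mul_le_mul_of_nonneg_left hγL hγ
  have h3 : γ ^ 2 * ‖T x - T y‖ ^ 2 ≤ 2 * γ * ⟪x - y, T x - T y⟫ := by
    calc γ ^ 2 * ‖T x - T y‖ ^ 2 ≤ γ * (2 / L) * ‖T x - T y‖ ^ 2 :=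
          mul_le_mul_of_nonneg_right h2 (sq_nonneg _)
      _ = 2 * γ * (1 / L * ‖T x - T y‖ ^ 2) := by ring
      _ ≤ 2 * γ * ⟪x - y, T x - T y⟫ := mul_le_mul_of_nonneg_left h1 (by positivity)
  nlinarith [h3]

end Elementary

/-! ## Functions with a Lipschitz gradient: the Taylor (descent) bound -/

section Gradient

variable [CompleteSpace E] {f : E → ℝ} {g : E → E} {x y : E}

/-- The derivative of `f` along the segment `t ↦ x + t • v`. [folklore] -/
private theorem hasDerivAt_comp_lineTo (hg : ∀ x, HasGradientAt f (g x) x) (x v : E) (t : ℝ) :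
    HasDerivAt (fun s : ℝ => f (x + s • v)) ⟪g (x + t • v), v⟫ t := by
  have hp : HasDerivAt (fun s : ℝ => x + s • v) v t := by
    simpa using ((hasDerivAt_id t).smul_const v).const_add x
  have := (hg (x + t • v)).hasFDerivAt.comp_hasDerivAt t hp
  simpa [Function.comp_def, toDual_apply_apply] using this

/-- Core of [WW22, Lemma 2.1 (i)⇒(iii)], without the integral: for `|σ| ≤ 1` the function
`t ↦ σ (f(x + tv) − f x − t⟪∇f x, v⟫) − (L/2) t² ‖v‖²` is non-increasing on `[0, ∞)`. [folklore] -/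
private theorem sigma_taylor_le (hg : ∀ x, HasGradientAt f (g x) x) {L : ℝ≥0}
    (hL : LipschitzWith L g) (x y : E) {σ : ℝ} (hσ : |σ| ≤ 1) :
    σ * (f y - f x - ⟪g x, y - x⟫) ≤ (L : ℝ) / 2 * ‖y - x‖ ^ 2 := by
  set v := y - x with hv
  set ψ : ℝ → ℝ := fun t =>
    σ * (f (x + t • v) - f x - t * ⟪g x, v⟫) - (L : ℝ) / 2 * t ^ 2 * ‖v‖ ^ 2 with hψ
  have hderiv : ∀ t, HasDerivAt ψ
      (σ * (⟪g (x + t • v), v⟫ - ⟪g x, v⟫) - (L : ℝ) * t * ‖v‖ ^ 2) t := by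
    intro t
    have h1 := hasDerivAt_comp_lineTo hg x v t
    have h2 : HasDerivAt (fun s : ℝ => s * ⟪g x, v⟫) ⟪g x, v⟫ t := by
      simpa using (hasDerivAt_id t).mul_const ⟪g x, v⟫
    have h3 : HasDerivAt (fun s : ℝ => s ^ 2) (2 * t) t := by
      simpa using hasDerivAt_pow 2 t
    have := (((h1.sub_const (f x)).sub h2).const_mul σ).sub
      ((h3.const_mul ((L : ℝ) / 2)).mul_const (‖v‖ ^ 2))
    refine this.congr_deriv ?_
    ring
  -- the derivative is `≤ 0` for `t > 0`
  have hderiv_nonpos : ∀ t : ℝ, 0 < t →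
      σ * (⟪g (x + t • v), v⟫ - ⟪g x, v⟫) - (L : ℝ) * t * ‖v‖ ^ 2 ≤ 0 := by
    intro t ht
    have h1 : ‖g (x + t • v) - g x‖ ≤ (L : ℝ) * (t * ‖v‖) := by
      have := hL.dist_le_mul (x + t • v) x
      rwa [dist_eq_norm, dist_eq_norm, add_sub_cancel_left, norm_smul, Real.norm_eq_abs,
        abs_of_pos ht] at this
    have h2 : |⟪g (x + t • v) - g x, v⟫| ≤ ‖g (x + t • v) - g x‖ * ‖v‖ :=
      abs_real_inner_le_norm _ _
    have h3 : σ * (⟪g (x + t • v), v⟫ - ⟪g x, v⟫) ≤ |⟪g (x + t • v) - g x, v⟫| := by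
      rw [← inner_sub_left]
      calc σ * ⟪g (x + t • v) - g x, v⟫ ≤ |σ * ⟪g (x + t • v) - g x, v⟫| := le_abs_self _
        _ = |σ| * |⟪g (x + t • v) - g x, v⟫| := abs_mul _ _
        _ ≤ 1 * |⟪g (x + t • v) - g x, v⟫| :=
          mul_le_mul_of_nonneg_right hσ (abs_nonneg _)
        _ = _ := one_mul _
    have h4 : ‖g (x + t • v) - g x‖ * ‖v‖ ≤ (L : ℝ) * (t * ‖v‖) * ‖v‖ :=
      mul_le_mul_of_nonneg_right h1 (norm_nonneg _)
    nlinarith [h2, h3, h4]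
  have hanti : AntitoneOn ψ (Ici 0) := by
    refine antitoneOn_of_deriv_nonpos (convex_Ici 0)
      (fun t _ => (hderiv t).differentiableAt.continuousAt.continuousWithinAt)
      (fun t _ => (hderiv t).differentiableAt.differentiableWithinAt) ?_
    intro t ht
    rw [interior_Ici] at ht
    rw [(hderiv t).deriv]
    exact hderiv_nonpos t ht
  have h10 : ψ 1 ≤ ψ 0 := hanti self_mem_Ici (mem_Ici.2 zero_le_one) zero_le_one
  have e0 : ψ 0 = 0 := by simp [hψ]
  have e1 : ψ 1 = σ * (f y - f x - ⟪g x, v⟫) - (L : ℝ) / 2 * ‖v‖ ^ 2 := by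
    simp [hψ, hv]
  linarith [h10, e0, e1]

/-- [WW22, Lemma 2.1 (i)⇒(iii)] on the whole space: if `∇f` is `L`-Lipschitz then
`|f y − f x − ⟪∇f x, y − x⟫| ≤ (L/2)‖y − x‖²` (no convexity needed).
[cite: WachsmuthWachsmuth2022, Lemma 2.1 (i)⇒(iii)] -/
theorem abs_sub_sub_inner_le (hg : ∀ x, HasGradientAt f (g x) x) {L : ℝ≥0}
    (hL : LipschitzWith L g) (x y : E) :
    |f y - f x - ⟪g x, y - x⟫| ≤ (L : ℝ) / 2 * ‖y - x‖ ^ 2 := by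
  rw [abs_le]
  constructor
  · have := sigma_taylor_le hg hL x y (σ := -1) (by simp)
    linarith
  · have := sigma_taylor_le hg hL x y (σ := 1) (by simp)
    linarith

/-- The DESCENT LEMMA: `f y ≤ f x + ⟪∇f x, y − x⟫ + (L/2)‖y − x‖²` for `∇f` `L`-Lipschitz.
[cite: WachsmuthWachsmuth2022, Lemma 2.1 (iii); Thm 3.1 (ii)] -/
theorem le_add_inner_add_of_lipschitzWith (hg : ∀ x, HasGradientAt f (g x) x) {L : ℝ≥0}
    (hL : LipschitzWith L g) (x y : E) :
    f y ≤ f x + ⟪g x, y - x⟫ + (L : ℝ) / 2 * ‖y - x‖ ^ 2 := by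
  have := (abs_le.1 (abs_sub_sub_inner_le hg hL x y)).2
  linarith

/-! ## The descent bound and convexity of `(L/2)‖·‖² − f` -/

omit [CompleteSpace E] in
/-- A function lying above each of its "tangent" affine functions `y ↦ φ x + ⟪p x, y − x⟫` is
convex. [folklore] -/
private theorem convexOn_univ_of_forall_le {φ : E → ℝ} {p : E → E}
    (h : ∀ x y, φ x + ⟪p x, y - x⟫ ≤ φ y) : ConvexOn ℝ univ φ := by
  refine ⟨convex_univ, fun x _ y _ a b ha hb hab => ?_⟩
  set z := a • x + b • y with hz
  have h1 := h z x
  have h2 := h z y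
  have e : a * ⟪p z, x - z⟫ + b * ⟪p z, y - z⟫ = 0 := by
    rw [← real_inner_smul_right, ← real_inner_smul_right, ← inner_add_right]
    have : a • (x - z) + b • (y - z) = 0 := by
      rw [smul_sub, smul_sub, show a • x - a • z + (b • y - b • z) = (a • x + b • y) - (a + b) • z by
        rw [add_smul]; abel, hab, one_smul, hz, sub_self]
    rw [this, inner_zero_right]
  obtain rfl : b = 1 - a := by linarith
  simp only [smul_eq_mul]
  nlinarith [mul_le_mul_of_nonneg_left h1 ha, mul_le_mul_of_nonneg_left h2 hb, e]

/-- The Fréchet derivative of `h = (L/2)‖·‖² − f`. [folklore] -/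
private theorem hasFDerivAt_half_sq_sub (hg : ∀ x, HasGradientAt f (g x) x) (L : ℝ) (x : E) :
    HasFDerivAt (fun z => L / 2 * ‖z‖ ^ 2 - f z) (toDual ℝ E (L • x - g x)) x := by
  have h := (((hasStrictFDerivAt_norm_sq x).hasFDerivAt).const_mul (L / 2)).sub
    (hg x).hasFDerivAt
  refine h.congr_fderiv ?_
  ext w
  simp [toDual_apply_apply]
  ring

omit [CompleteSpace E] in
/-- `‖y‖² − ‖x‖² − 2⟪x, y − x⟫ = ‖y − x‖²`. [folklore] -/
private theorem norm_sq_sub_norm_sq_sub_two_inner (x y : E) :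
    ‖y‖ ^ 2 - ‖x‖ ^ 2 - 2 * ⟪x, y - x⟫ = ‖y - x‖ ^ 2 := by
  rw [norm_sub_sq_real, inner_sub_right, real_inner_self_eq_norm_sq, real_inner_comm]
  ring

/-- For differentiable `f` and any real `L`: `(L/2)‖·‖² − f` is convex iff the descent bound
`f y ≤ f x + ⟪∇f x, y − x⟫ + (L/2)‖y − x‖²` holds for all `x, y`.
[cite: WachsmuthWachsmuth2022, Thm 2.5 (proof of (i)⇔(ii)); BauschkeCombettes2010, Thm 2.1 (ii)] -/
theorem convexOn_half_sq_sub_iff (hg : ∀ x, HasGradientAt f (g x) x) (L : ℝ) :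
    ConvexOn ℝ univ (fun z => L / 2 * ‖z‖ ^ 2 - f z) ↔
      ∀ x y, f y ≤ f x + ⟪g x, y - x⟫ + L / 2 * ‖y - x‖ ^ 2 := by
  constructor
  · intro hh x y
    have := ConvexOn.apply_add_fderiv_le hh (mem_univ x) (hasFDerivAt_half_sq_sub hg L x)
      (mem_univ y)
    simp only [toDual_apply_apply, inner_sub_left, real_inner_smul_left] at this
    rw [← norm_sq_sub_norm_sq_sub_two_inner x y]
    linarith
  · intro hD
    refine convexOn_univ_of_forall_le (p := fun z => L • z - g z) fun x y => ?_
    have h1 := hD x y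
    rw [← norm_sq_sub_norm_sq_sub_two_inner x y] at h1
    simp only [inner_sub_left, real_inner_smul_left]
    linarith

/-- Hence, for `∇f` `L`-Lipschitz, `(L/2)‖·‖² − f` is convex (no convexity of `f` needed).
[cite: WachsmuthWachsmuth2022, Thm 2.5 (i)⇒(ii); BauschkeCombettes2010, Thm 2.1 (i)⇒(ii)] -/
theorem convexOn_half_sq_sub_of_lipschitzWith (hg : ∀ x, HasGradientAt f (g x) x) {L : ℝ≥0}
    (hL : LipschitzWith L g) : ConvexOn ℝ univ (fun z => (L : ℝ) / 2 * ‖z‖ ^ 2 - f z) :=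
  (convexOn_half_sq_sub_iff hg L).2 (le_add_inner_add_of_lipschitzWith hg hL)

/-! ## Convex `f`: the interpolation inequality and the Baillon–Haddad theorem -/

/-- The INTERPOLATION INEQUALITY: if `f` is convex and differentiable and satisfies the descent
bound with constant `L`, then `f y ≥ f x + ⟪∇f x, y − x⟫ + (1/(2L))‖∇f y − ∇f x‖²`
(for `L = 0` the last term is `0` by the `1/0 = 0` convention and the claim is convexity).
[cite: WachsmuthWachsmuth2022, Thm 3.1 (vi) with (c); Nesterov2004, Thm 2.1.5] -/
theorem add_inner_add_norm_sub_sq_le (hf : ConvexOn ℝ univ f) (hg : ∀ x, HasGradientAt f (g x) x)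
    {L : ℝ} (hD : ∀ x y, f y ≤ f x + ⟪g x, y - x⟫ + L / 2 * ‖y - x‖ ^ 2) (x y : E) :
    f x + ⟪g x, y - x⟫ + 1 / (2 * L) * ‖g y - g x‖ ^ 2 ≤ f y := by
  set d := g y - g x with hd
  set y' := y - (1 / L) • d with hy'
  -- descent from `y` to `y'`, convexity (tangent at `x`) at `y'`
  have h1 := hD y y'
  have h2 : f x + ⟪g x, y' - x⟫ ≤ f y' := by
    have := ConvexOn.apply_add_fderiv_le hf (mem_univ x) (hg x).hasFDerivAt (mem_univ y')
    simpa [toDual_apply_apply] using this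
  have e1 : y' - y = -((1 / L) • d) := by rw [hy']; abel
  have e2 : y' - x = (y - x) - (1 / L) • d := by rw [hy']; abel
  rw [e1, inner_neg_right, real_inner_smul_right, norm_neg, norm_smul, Real.norm_eq_abs, mul_pow,
    sq_abs] at h1
  rw [e2, inner_sub_right, real_inner_smul_right] at h2
  have e3 : ⟪g y, d⟫ - ⟪g x, d⟫ = ‖d‖ ^ 2 := by
    rw [← inner_sub_left, ← hd, real_inner_self_eq_norm_sq]
  have e4 : 1 / L - L / 2 * (1 / L) ^ 2 = 1 / (2 * L) := by
    by_cases hL : L = 0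
    · simp [hL]
    · field_simp; ring
  have e5 : 1 / L * ⟪g y, d⟫ - 1 / L * ⟪g x, d⟫ = 1 / L * ‖d‖ ^ 2 := by rw [← mul_sub, e3]
  have : f x + ⟪g x, y - x⟫ + (1 / L - L / 2 * (1 / L) ^ 2) * ‖d‖ ^ 2 ≤ f y := by
    linarith [h1, h2, e5]
  rwa [e4] at this

/-- THE BAILLON–HADDAD THEOREM [BH77, Cor. 10], cocoercive form: for convex differentiable `f`
with `L`-Lipschitz gradient, `(1/L)‖∇f x − ∇f y‖² ≤ ⟪x − y, ∇f x − ∇f y⟫`.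
[cite: BaillonHaddad1977, Corollaire 10; BauschkeCombettes2010, Thm 1.1, Thm 2.1 (i)⇒(vi); WachsmuthWachsmuth2022, Thm 2.5 (i)⇒(iii)] -/
theorem isCocoercive_of_convexOn (hf : ConvexOn ℝ univ f) (hg : ∀ x, HasGradientAt f (g x) x)
    {L : ℝ≥0} (hL : LipschitzWith L g) : IsCocoercive (1 / (L : ℝ)) g := by
  intro x y
  have hD := le_add_inner_add_of_lipschitzWith hg hL
  have h1 := add_inner_add_norm_sub_sq_le hf hg hD x y
  have h2 := add_inner_add_norm_sub_sq_le hf hg hD y x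
  have e : ⟪g x, y - x⟫ + ⟪g y, x - y⟫ = -⟪x - y, g x - g y⟫ := by
    rw [inner_sub_right, inner_sub_right, inner_sub_left, inner_sub_right, inner_sub_right,
      real_inner_comm x (g x), real_inner_comm y (g x), real_inner_comm x (g y),
      real_inner_comm y (g y)]
    ring
  have e2 : ‖g y - g x‖ = ‖g x - g y‖ := norm_sub_rev _ _
  rw [e2] at h1
  have e3 : 1 / (2 * (L : ℝ)) * ‖g x - g y‖ ^ 2 + 1 / (2 * (L : ℝ)) * ‖g x - g y‖ ^ 2 =
      1 / (L : ℝ) * ‖g x - g y‖ ^ 2 := by ring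
  linarith

/-- The Baillon–Haddad theorem, product form (valid for every `L ≥ 0`):
`‖∇f x − ∇f y‖² ≤ L ⟪x − y, ∇f x − ∇f y⟫`.
[cite: BaillonHaddad1977, Corollaire 10; BauschkeCombettes2010, Thm 1.1] -/
theorem norm_sub_sq_le_mul_inner (hf : ConvexOn ℝ univ f) (hg : ∀ x, HasGradientAt f (g x) x)
    {L : ℝ≥0} (hL : LipschitzWith L g) (x y : E) :
    ‖g x - g y‖ ^ 2 ≤ (L : ℝ) * ⟪x - y, g x - g y⟫ := by
  rcases eq_or_ne L 0 with rfl | hL0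
  · have : g x = g y := by
      have := hL.dist_le_mul x y
      simp only [NNReal.coe_zero, zero_mul, dist_le_zero] at this
      exact this
    simp [this]
  · have hLpos : (0 : ℝ) < L := by exact_mod_cast pos_iff_ne_zero.2 hL0
    have := mul_le_mul_of_nonneg_left (isCocoercive_of_convexOn hf hg hL x y) hLpos.le
    rwa [← mul_assoc, mul_one_div_cancel hLpos.ne', one_mul] at this

/-- The Baillon–Haddad theorem as an equivalence (`L > 0`): for convex differentiable `f`,
`∇f` is `L`-Lipschitz iff `∇f` is `1/L`-cocoercive.
[cite: BaillonHaddad1977, Corollaire 10; BauschkeCombettes2010, Thm 2.1 (i)⇔(vi); WachsmuthWachsmuth2022, Thm 2.5 (i)⇔(iii)] -/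
theorem lipschitzWith_iff_isCocoercive (hf : ConvexOn ℝ univ f) (hg : ∀ x, HasGradientAt f (g x) x)
    {L : ℝ≥0} (hL : 0 < L) : LipschitzWith L g ↔ IsCocoercive (1 / (L : ℝ)) g :=
  ⟨isCocoercive_of_convexOn hf hg, IsCocoercive.lipschitzWith hL⟩

/-- [WW22, Thm 2.5 (i)⇔(ii)] / [BC10, Thm 2.1 (i)⇔(ii)] (`L > 0`): for convex differentiable `f`,
`∇f` is `L`-Lipschitz iff `(L/2)‖·‖² − f` is convex.
[cite: WachsmuthWachsmuth2022, Thm 2.5 (i)⇔(ii); BauschkeCombettes2010, Thm 2.1 (i)⇔(ii)] -/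
theorem lipschitzWith_iff_convexOn_half_sq_sub (hf : ConvexOn ℝ univ f)
    (hg : ∀ x, HasGradientAt f (g x) x) {L : ℝ≥0} (hL : 0 < L) :
    LipschitzWith L g ↔ ConvexOn ℝ univ (fun z => (L : ℝ) / 2 * ‖z‖ ^ 2 - f z) := by
  refine ⟨convexOn_half_sq_sub_of_lipschitzWith hg, fun hh => ?_⟩
  have hD := (convexOn_half_sq_sub_iff hg (L : ℝ)).1 hh
  refine IsCocoercive.lipschitzWith hL fun x y => ?_
  have h1 := add_inner_add_norm_sub_sq_le hf hg hD x y
  have h2 := add_inner_add_norm_sub_sq_le hf hg hD y x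
  have e : ⟪g x, y - x⟫ + ⟪g y, x - y⟫ = -⟪x - y, g x - g y⟫ := by
    rw [inner_sub_right, inner_sub_right, inner_sub_left, inner_sub_right, inner_sub_right,
      real_inner_comm x (g x), real_inner_comm y (g x), real_inner_comm x (g y),
      real_inner_comm y (g y)]
    ring
  have e2 : ‖g y - g x‖ = ‖g x - g y‖ := norm_sub_rev _ _
  rw [e2] at h1
  have e3 : 1 / (2 * (L : ℝ)) * ‖g x - g y‖ ^ 2 + 1 / (2 * (L : ℝ)) * ‖g x - g y‖ ^ 2 =
      1 / (L : ℝ) * ‖g x - g y‖ ^ 2 := by ring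
  linarith

/-- [Com18, Thm 2.2 (i)⇒(ii)] (the case `L = 1`): the gradient of a convex function is firmly
nonexpansive as soon as it is nonexpansive — in the graph language of
`Literature.Analysis.Convex.MonotoneOperatorResolvent`.
[cite: Combettes2018, Thm 2.2 (i)⇒(ii); BauschkeCombettes2010, Remark 2.2 (b)] -/
theorem isFirmlyNonexpansive_graph_of_convexOn (hf : ConvexOn ℝ univ f)
    (hg : ∀ x, HasGradientAt f (g x) x) (h1 : LipschitzWith 1 g) :
    MonotoneOperator.IsFirmlyNonexpansive (MonotoneOperator.graph g) := by
  rw [← isCocoercive_one_iff_isFirmlyNonexpansive_graph]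
  simpa using isCocoercive_of_convexOn hf hg h1

/-- Consequence for the gradient method: for convex `f` with `L`-Lipschitz gradient and a step
`0 ≤ γ ≤ 2/L`, the gradient step `x ↦ x − γ ∇f x` is nonexpansive.
[cite: BauschkeCombettes2010, Remark 2.2 (c); WachsmuthWachsmuth2022, Lemma 2.3] -/
theorem norm_gradientStep_sub_le (hf : ConvexOn ℝ univ f) (hg : ∀ x, HasGradientAt f (g x) x)
    {L : ℝ≥0} (hL : LipschitzWith L g) {γ : ℝ} (hγ : 0 ≤ γ) (hγL : γ ≤ 2 / (L : ℝ)) (x y : E) :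
    ‖(x - γ • g x) - (y - γ • g y)‖ ≤ ‖x - y‖ :=
  (isCocoercive_of_convexOn hf hg hL).norm_forwardStep_sub_le hγ hγL x y

end Gradient

end Literature.Analysis.Convex.BaillonHaddad

end
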